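import Summits.ResolutionOfSingularities.ResolutionOfSingularities.Theorems.EquisingularLiftEquisingularLiftNatQuasiRegularPairCodimTwo
import HarnessLib

/-!
# [OURS · L1 W4.5(b) · EL♮(3)] T-CENTRE-2FRAME (i) — quasi-regular 2-frames of a regular codimension-2 centre, from regularity
# (the input `hCframe` of res-L1-w45b-stub-2's `DirLift.ruled_curveStep_root` / `ruled_round_root`)
# (crux `EquisingularLiftNatThree` stmt-ResolutionOfSingularities-20148 / parent 20038; rungs CONE-TOWER₃ / DIR₀₀, S1/S2 inputs)

NOT a statement of any manuscript. Helper file of the chain res-L1-w45b (cell `res-hironaka`, LADDER-RESOLUTION rung L, slot W4.5(b));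
OURS; AI-written, weaker than expert review; `--supports stmt-ResolutionOfSingularities-20148 --as helper` by res-L1-w45b-stub-3
(res-L1-w45b-plan-1 NAMING 2026-08-27T19:39:10Z «T-CENTRE-2FRAME», ADDENDUM 19:43:16Z: part (i) here; part (ii) «stalk 2-frames ⇒
`IsRegularImmersionOfCodim 𝒞.subschemeι 2`» needs affine-open weakly regular sequences (spreading out) and is left with its signature in
the HANDOFF). No `sorry`; standard axioms; no definitions.

WHAT. For an ideal sheaf `𝒞` on `X` with `V(𝒞)` a regular scheme and a point `x ∈ supp 𝒞` at which `𝒪_{X,x}` is regular and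
`dim (𝒪_{X,x} ⧸ 𝒞_x) + 2 = dim 𝒪_{X,x}`, the stalk `𝒞_x` is generated by a QUASI-REGULAR pair:
* `exists_twoFrame_of_codim_two` — at one point;
* **`forall_exists_twoFrame_of_isRegular`** — `hCframe` verbatim: `∀ x ∈ 𝒞.support, ∃ c : Fin 2 → 𝒪_{X,x}, (c) = 𝒞_x ∧ IsQuasiRegular c`
  for `X` regular, `V(𝒞)` regular, and the codimension-2 clause at the points of `supp 𝒞`.
Proof: `𝒪_{V(𝒞),s} ≅ 𝒪_{X,x} ⧸ 𝒞_x` is regular, so `𝒞_x` is generated by a sub-family of any generating set with independent differentials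
(`exists_span_eq_of_isRegularLocalRing_quotient`, Matsumura 14.2); the dimension count (`RegularParameters.isRegularLocalRing_quotient_span_range`)
gives exactly `2` members; quasi-regularity is res-L1-w45b-stub-2's `isQuasiRegular_of_span_pair_eq_stalkIdeal` (Matsumura 16.2).

presearch: «regular local ring, regular quotient ⇒ ideal generated by part of a regular system of parameters; regular sequence ⇒ quasi-regular»
→ IN-TREE (Literature `RegularQuotientIdeal` / `RegularParameterQuotient`, res-L1-w45b-stub-2 …NatQuasiRegularPairCodimTwo) [cite: Matsumura1987,
Thm. 14.2, Thm. 16.2]; nothing new needed from the corpus.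

References: H. Matsumura, *Commutative Ring Theory* (1986), Thms. 14.2, 16.2 [cite: Matsumura1987]; res-L1-w45b-stub-2 …NatQuasiRegularPairCodimTwo.
-/

set_option linter.dupNamespace false -- mandated namespace `Summit.<Summit>.<Problem>` of this single-conjunct summit

noncomputable section

open CategoryTheory AlgebraicGeometry IsLocalRing
open Literature.AlgebraicGeometry.Resolution
open AlgebraicGeometry.Scheme.IdealSheafData

namespace Summit.ResolutionOfSingularities.ResolutionOfSingularities.Cruxes.EquisingularLiftNat.Sections

universe u

/-- **A regular codimension-`2` centre has a quasi-regular 2-frame at each of its points.** For an ideal sheaf `𝒞` with `V(𝒞)`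
regular, a point `s` of `V(𝒞)` with `𝒪_{X,ι s}` regular and `dim (𝒪_{X,ι s} ⧸ 𝒞_{ι s}) + 2 = dim 𝒪_{X,ι s}`, there is
`c : Fin 2 → 𝒪_{X,ι s}` with `(c 0, c 1) = 𝒞_{ι s}` and `c` quasi-regular. [cite: Matsumura1987, Thm. 14.2 with Thm. 16.2] -/
theorem exists_twoFrame_of_codim_two {X : Scheme.{u}} (𝒞 : X.IdealSheafData) (h𝒞 : Scheme.IsRegular 𝒞.subscheme)
    (s : 𝒞.subscheme) [IsRegularLocalRing (X.presheaf.stalk (𝒞.subschemeι s))]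
    (hcodim : ringKrullDim (X.presheaf.stalk (𝒞.subschemeι s) ⧸ stalkIdeal 𝒞 (𝒞.subschemeι s)) + 2 =
      ringKrullDim (X.presheaf.stalk (𝒞.subschemeι s))) :
    ∃ c : Fin 2 → X.presheaf.stalk (𝒞.subschemeι s),
      Ideal.span (Set.range c) = stalkIdeal 𝒞 (𝒞.subschemeι s) ∧ IsQuasiRegular c := by
  classical
  -- `𝒪_{V(𝒞),s} ≅ 𝒪_{X,x} ⧸ 𝒞_x` is regular
  have hsurj : Function.Surjective (𝒞.subschemeι.stalkMap s).hom := 𝒞.subschemeι.stalkMap_surjective s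
  have hker : RingHom.ker (𝒞.subschemeι.stalkMap s).hom = stalkIdeal 𝒞 (𝒞.subschemeι s) := by
    rw [← stalkIdeal_ker_eq_ker_stalkMap, Scheme.IdealSheafData.ker_subschemeι]
  haveI := h𝒞 s
  haveI hq : IsRegularLocalRing (X.presheaf.stalk (𝒞.subschemeι s) ⧸ stalkIdeal 𝒞 (𝒞.subschemeι s)) :=
    IsRegularLocalRing.of_ringEquiv
      (((RingHom.quotientKerEquivOfSurjective hsurj).symm).trans (Ideal.quotEquivOfEq hker))
  have hx : 𝒞.subschemeι s ∈ (𝒞.support : Set X) := by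
    rw [← Scheme.IdealSheafData.range_subschemeι]; exact ⟨s, rfl⟩
  have hJ : stalkIdeal 𝒞 (𝒞.subschemeι s) ≤ maximalIdeal _ := (mem_support_iff_stalkIdeal_le 𝒞 _).mp hx
  -- a generating family with independent differentials; it has exactly `2` members
  obtain ⟨n, f, hfG, hspan, hli⟩ := exists_span_eq_of_isRegularLocalRing_quotient hJ
    (stalkIdeal 𝒞 (𝒞.subschemeι s) : Set _) (Ideal.span_eq _)
  have hf𝔪 : ∀ i, f i ∈ maximalIdeal _ := fun i => hJ (hspan ▸ Ideal.subset_span ⟨i, rfl⟩)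
  have hdim := (RegularParameters.isRegularLocalRing_quotient_span_range f hf𝔪
    (forall_mem_maximalIdeal_of_linearIndependent_toCotangent f hf𝔪 hli)).2
  rw [hspan] at hdim
  have hn : n = 2 := by
    obtain ⟨d, hd⟩ := exists_ringKrullDim_eq_natCast (X.presheaf.stalk (𝒞.subschemeι s) ⧸ stalkIdeal 𝒞 (𝒞.subschemeι s))
    have h := hdim.trans hcodim.symm
    rw [hd] at h
    have h' : ((d + n : ℕ) : WithBot ℕ∞) = ((d + 2 : ℕ) : WithBot ℕ∞) := by push_cast; exact h
    have h'' : d + n = d + 2 := by exact_mod_cast h'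
    omega
  subst hn
  exact ⟨f, hspan, isQuasiRegular_of_span_pair_eq_stalkIdeal 𝒞 h𝒞 s hcodim f hspan⟩

/-- **T-CENTRE-2FRAME (i) — `hCframe` from regularity.** For `X` regular and a centre `𝒞` with `V(𝒞)` regular and of codimension `2`
at its points (`dim (𝒪_{X,x} ⧸ 𝒞_x) + 2 = dim 𝒪_{X,x}` on `supp 𝒞`): every point of `supp 𝒞` carries a quasi-regular 2-frame of `𝒞`
— the hypothesis `hCframe` of res-L1-w45b-stub-2's `DirLift.ruled_curveStep_root` / `ruled_round_root`, verbatim.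
[cite: Matsumura1987, Thm. 14.2 with Thm. 16.2] [OURS · L1 W4.5b] T-CENTRE-2FRAME (i); NOT a statement of the manuscript. -/
theorem forall_exists_twoFrame_of_isRegular {X : Scheme.{u}} (hX : Scheme.IsRegular X) (𝒞 : X.IdealSheafData)
    (h𝒞 : Scheme.IsRegular 𝒞.subscheme)
    (hcodim : ∀ x ∈ 𝒞.support, ringKrullDim (X.presheaf.stalk x ⧸ stalkIdeal 𝒞 x) + 2 = ringKrullDim (X.presheaf.stalk x)) :
    ∀ x ∈ 𝒞.support, ∃ c : Fin 2 → X.presheaf.stalk x, Ideal.span (Set.range c) = stalkIdeal 𝒞 x ∧ IsQuasiRegular c := by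
  intro x hx
  have hx' : x ∈ Set.range 𝒞.subschemeι := by
    rw [Scheme.IdealSheafData.range_subschemeι]; exact hx
  obtain ⟨s, rfl⟩ := hx'
  haveI := hX (𝒞.subschemeι s)
  exact exists_twoFrame_of_codim_two 𝒞 h𝒞 s (hcodim _ hx)

end Summit.ResolutionOfSingularities.ResolutionOfSingularities.Cruxes.EquisingularLiftNat.Sections

end
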